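import Literature.AlgebraicGeometry.AbelianSchemes.AbelianSchemeQuotientDualPairRigidified
import Literature.AlgebraicGeometry.AbelianSchemes.DualPairUniqueOfStabilizer
import Literature.AlgebraicGeometry.AbelianSchemes.AbelianSchemeConstSubgroupQuotientSmooth
import HarnessLib

/-!
# Uniqueness of the classifying map for the rigidified Poincaré sheaf of `A/K`, from the stabiliser hypothesis (K)
# (HECKE-LINK H2, file (ii) D6 brick (u3) by name)

Layer `Literature/AlgebraicGeometry/AbelianSchemes`, namespace `Literature.AlgebraicGeometry.AbelianSchemes.AbelianSchemeOver`.
THEOREMS ONLY; no definition, no named fact, no instance, no notation, no `sorry`.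

Setting of ★ `AbelianSchemeQuotientDualPairRigidified` ((ii) part 3): `B := A/K`, `𝒩₁` on `B ×_S Â` (★ `poincarePullbackBundle`),
`ψ̂ : Â → Â/K′` (★ `quotientMk`), the rigidified descended Poincaré sheaf `𝒫_B^{rig}` (★ `poincareQuotRigid`) with
`(B ◁ ψ̂)^* 𝒫_B^{rig} ≅ 𝒩₁` (★ `nonempty_pullback_whiskerLeft_poincareQuotRigid_iso`).  [MumfordAV1970] §15 Thm. 1: the
UNIQUENESS half of the universal property of `(Â/K′, 𝒫_B^{rig})` over EVERY test scheme `T` follows from the stabiliser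
hypothesis **(K)** «for `f : T → S` and `a a′ : T → Â` over `f`, `(1_B × a)^*𝒩₁ ≅ (1_B × a′)^*𝒩₁` implies `a ≫ ψ̂ = a′ ≫ ψ̂`»
(the scheme-theoretic stabiliser of `𝒩₁` is the constant group `K′`; brick (u4) of the cell's plan) by ★
`eq_of_pullback_baseChangeToProd_iso_of_stabilizer` (fpqc descent of morphisms along `(T ×_{B̂} Â) ×_T (T ×_{B̂} Â) → T`,
[GortzWedhorn2020] Thm. 14.72):

* `flat_quotientMk_left'` / `quasiCompact_quotientMk_left'` — ★ `flat_quotientMk_left` / ★ `isAffineHom_quotientMk_left` keyed on the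
  `quotientBy`-typed spelling of `ψ̂` (the spelling of ★ `nonempty_pullback_whiskerLeft_poincareQuotRigid_iso`);
* **`eq_of_pullback_baseChangeToProd_poincareQuotRigid_iso (hStab)`** — two `S`-morphisms `g₁ g₂ : T → Â/K′` with
  `(1_B × g₁)^* 𝒫_B^{rig} ≅ (1_B × g₂)^* 𝒫_B^{rig}` are equal;
* **`existsUnique_poincareQuotRigid_of_exists (hStab) (f) (L) (hex)`** — the `∃!` of ★ `DualPair.universal` for
  `(Â/K′, 𝒫_B^{rig})` from its `∃` half; so the `h4` binder of ★ `dualPairOfQuotientRigidified` is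
  `fun f ℒ hℒ => existsUnique_poincareQuotRigid_of_exists … hStab f ℒ.L (hex f ℒ hℒ)` once (K) (brick (u4)) and the EXISTENCE
  half (bricks (u1)+(u2)) are in hand.

HC_CM is proved only modulo the 7 printed citations until rung 0 closes; nothing here is about HC.

## References
* [MumfordAV1970] D. Mumford, *Abelian Varieties* (1970), §7 Thm. 4 (p. 72), §12 Thm. 1 (p. 112), §15 Thm. 1 (p. 143).
* [MilneAV2008] J. S. Milne, *Abelian Varieties* (2008), I §8 (pp. 36–37), I §9 Thm. 9.1 (p. 42).
* [GortzWedhorn2020] U. Görtz, T. Wedhorn, *Algebraic Geometry I*, 2nd ed. (2020), Thm. 14.72.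
-/

noncomputable section

universe u

open CategoryTheory CategoryTheory.Limits AlgebraicGeometry MonoidalCategory CartesianMonoidalCategory
open scoped MonObj

namespace Literature.AlgebraicGeometry.AbelianSchemes

namespace AbelianSchemeOver

open Literature.AlgebraicGeometry.RelativeSpec Literature.AlgebraicGeometry.AbelianVarieties
  Literature.AlgebraicGeometry.Motives Literature.AlgebraicGeometry.Modules

variable {S : Scheme.{u}} (A : AbelianSchemeOver S)
  {Y : Scheme.{u}} (u : S ⟶ Y) (K : Subgroup A.Sections) [IsCommMonObj A.X] {n : ℕ}
  (hK : ∀ σ : K, (σ : A.Sections) ^ n = 1)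
  [Finite K] [Y.IsSeparated] [IsSeparated (A.X.hom ≫ u)] [S.IsSeparated]
  (hcov : ∀ x : A.left, ∃ O : (A.translationActionOver u K).StableAffineOpens, x ∈ O.1)
  [LocallyOfFiniteType (A.X.hom ≫ u)] [IsLocallyNoetherian Y]
  (hG : ∃ _ : GrpObj (A.quotientOver u K), IsMonHom (A.quotientMk u K hcov))
  (hsm : Smooth (A.quotientOver u K).hom) (hgc : GeometricallyConnected (A.quotientOver u K).hom)
  (D : A.DualPair) [IsAffine Y]
  (hfree : ∀ (Ω : Type u) [Field Ω] [IsAlgClosed Ω] (x : Spec (.of Ω) ⟶ A.left) (σ : K), σ ≠ 1 →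
    x ≫ (A.translation (σ : A.Sections)).left ≠ x)

variable
  -- the dual side: a finite subgroup `K′ ≤ Â(S)` with the file-(i) hypotheses for `(Â, K′)`
  (K' : Subgroup D.hat.Sections) [Finite K'] [IsSeparated (D.hat.X.hom ≫ u)]
  (hcov' : ∀ x : D.hat.left, ∃ O : (D.hat.translationActionOver u K').StableAffineOpens, x ∈ O.1)
  [LocallyOfFiniteType (D.hat.X.hom ≫ u)]
  (hG' : ∃ _ : GrpObj (D.hat.quotientOver u K'), IsMonHom (D.hat.quotientMk u K' hcov'))
  (hsm' : Smooth (D.hat.quotientOver u K').hom) (hgc' : GeometricallyConnected (D.hat.quotientOver u K').hom)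
  (hfree' : ∀ (Ω : Type u) [Field Ω] [IsAlgClosed Ω] (x : Spec (.of Ω) ⟶ D.hat.left) (σ : K'), σ ≠ 1 →
    x ≫ (D.hat.translation (σ : D.hat.Sections)).left ≠ x)
  -- D3b's output: a `K′`-equivariant structure on `𝒩₁` for the D3a action
  (Φ : (prodTranslationActionOver (A.quotientBy u K hcov hG hsm hgc) D.hat u K' hcov').EquivariantStructure
    (A.poincarePullback u K hK hcov hG hsm hgc D hfree))

omit [IsCommMonObj A.X] [Finite K] [IsSeparated (A.X.hom ≫ u)] [LocallyOfFiniteType (A.X.hom ≫ u)] in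
include hfree' in
/-- `ψ̂ : Â → Â/K′` is flat (★ `flat_quotientMk_left`: a free finite quotient), on the `quotientBy`-typed spelling of `ψ̂`.
[cite: MumfordAV1970, §12 Thm. 1 (p. 112)] -/
theorem flat_quotientMk_left' :
    Flat (show D.hat.X ⟶ (D.hat.quotientBy u K' hcov' hG' hsm' hgc').X from D.hat.quotientMk u K' hcov').left :=
  D.hat.flat_quotientMk_left u K' hcov' hfree'

omit [IsCommMonObj A.X] [Finite K] [IsSeparated (A.X.hom ≫ u)] [LocallyOfFiniteType (A.X.hom ≫ u)] [IsAffine Y] in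
/-- `ψ̂ : Â → Â/K′` is quasi-compact (affine: ★ `isAffineHom_quotientMk_left`), on the `quotientBy`-typed spelling of `ψ̂`.
[cite: MumfordAV1970, §7 Thm. 4 (p. 72)] -/
theorem quasiCompact_quotientMk_left' :
    QuasiCompact (show D.hat.X ⟶ (D.hat.quotientBy u K' hcov' hG' hsm' hgc').X from D.hat.quotientMk u K' hcov').left := by
  haveI : IsAffineHom (show D.hat.X ⟶ (D.hat.quotientBy u K' hcov' hG' hsm' hgc').X from D.hat.quotientMk u K' hcov').left :=
    D.hat.isAffineHom_quotientMk_left u K' hcov'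
  infer_instance

include hfree' in
/-- **Uniqueness of the classifying map for `𝒫_B^{rig}` over EVERY test scheme, from (K).**  If the scheme-theoretic stabiliser of
`𝒩₁` is `K′` — (K): for all `f : T → S` and `a a′ : T → Â` over `f`, `(1_B × a)^*𝒩₁ ≅ (1_B × a′)^*𝒩₁` implies `a ≫ ψ̂ = a′ ≫ ψ̂` —
then two `S`-morphisms `g₁ g₂ : T → Â/K′` with `(1_B × g₁)^* 𝒫_B^{rig} ≅ (1_B × g₂)^* 𝒫_B^{rig}` are equal (★
`eq_of_pullback_baseChangeToProd_iso_of_stabilizer` along the fpqc cover `ψ̂`). [cite: MumfordAV1970, §15 Thm. 1 (p. 143)]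
[cite: GortzWedhorn2020, Thm. 14.72] -/
theorem eq_of_pullback_baseChangeToProd_poincareQuotRigid_iso
    (hStab : ∀ {T : Scheme.{u}} (f : T ⟶ S) (a a' : T ⟶ D.hat.X.left) (ha : a ≫ D.hat.X.hom = f)
      (ha' : a' ≫ D.hat.X.hom = f),
      Nonempty ((Scheme.Modules.pullback ((A.quotientBy u K hcov hG hsm hgc).baseChangeToProd D.hat f a ha)).obj
          (A.poincarePullbackBundle u K hK hcov hG hsm hgc D hfree).L ≅
        (Scheme.Modules.pullback ((A.quotientBy u K hcov hG hsm hgc).baseChangeToProd D.hat f a' ha')).obj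
          (A.poincarePullbackBundle u K hK hcov hG hsm hgc D hfree).L) →
      a ≫ (D.hat.quotientMk u K' hcov').left = a' ≫ (D.hat.quotientMk u K' hcov').left)
    {T : Scheme.{u}} (f : T ⟶ S) (g₁ g₂ : T ⟶ (D.hat.quotientBy u K' hcov' hG' hsm' hgc').X.left)
    (hg₁ : g₁ ≫ (D.hat.quotientBy u K' hcov' hG' hsm' hgc').X.hom = f)
    (hg₂ : g₂ ≫ (D.hat.quotientBy u K' hcov' hG' hsm' hgc').X.hom = f)
    (h : Nonempty ((Scheme.Modules.pullback ((A.quotientBy u K hcov hG hsm hgc).baseChangeToProd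
        (D.hat.quotientBy u K' hcov' hG' hsm' hgc') f g₁ hg₁)).obj
          (A.poincareQuotRigid u K hK hcov hG hsm hgc D hfree K' hcov' hG' hsm' hgc' Φ) ≅
      (Scheme.Modules.pullback ((A.quotientBy u K hcov hG hsm hgc).baseChangeToProd
        (D.hat.quotientBy u K' hcov' hG' hsm' hgc') f g₂ hg₂)).obj
          (A.poincareQuotRigid u K hK hcov hG hsm hgc D hfree K' hcov' hG' hsm' hgc' Φ))) :
    g₁ = g₂ := by
  haveI : Surjective (show D.hat.X ⟶ (D.hat.quotientBy u K' hcov' hG' hsm' hgc').X from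
      D.hat.quotientMk u K' hcov').left := ⟨D.hat.quotientMk_left_surjective u K' hcov'⟩
  haveI := A.flat_quotientMk_left' u D K' hcov' hG' hsm' hgc' hfree'
  haveI := A.quasiCompact_quotientMk_left' u D K' hcov' hG' hsm' hgc'
  exact (A.quotientBy u K hcov hG hsm hgc).eq_of_pullback_baseChangeToProd_iso_of_stabilizer D.hat
    (D.hat.quotientBy u K' hcov' hG' hsm' hgc')
    (show D.hat.X ⟶ (D.hat.quotientBy u K' hcov' hG' hsm' hgc').X from D.hat.quotientMk u K' hcov')
    (A.poincarePullbackBundle u K hK hcov hG hsm hgc D hfree).L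
    (A.poincareQuotRigid u K hK hcov hG hsm hgc D hfree K' hcov' hG' hsm' hgc' Φ)
    (A.nonempty_pullback_whiskerLeft_poincareQuotRigid_iso u K hK hcov hG hsm hgc D hfree K' hcov' hG' hsm' hgc' hfree' Φ)
    hStab f g₁ g₂ hg₁ hg₂ h

include hfree' in
/-- **The `∃!` of ★ `DualPair.universal` for `(Â/K′, 𝒫_B^{rig})` from its `∃` half and (K)** (★
`existsUnique_of_exists_of_stabilizer`); the `h4` binder of ★ `dualPairOfQuotientRigidified` is
`fun f ℒ hℒ => existsUnique_poincareQuotRigid_of_exists … hStab f ℒ.L (hex f ℒ hℒ)`. [cite: MumfordAV1970, §15 Thm. 1 (p. 143)]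
[cite: MilneAV2008, I §9 Thm. 9.1 (p. 42)] -/
theorem existsUnique_poincareQuotRigid_of_exists
    (hStab : ∀ {T : Scheme.{u}} (f : T ⟶ S) (a a' : T ⟶ D.hat.X.left) (ha : a ≫ D.hat.X.hom = f)
      (ha' : a' ≫ D.hat.X.hom = f),
      Nonempty ((Scheme.Modules.pullback ((A.quotientBy u K hcov hG hsm hgc).baseChangeToProd D.hat f a ha)).obj
          (A.poincarePullbackBundle u K hK hcov hG hsm hgc D hfree).L ≅
        (Scheme.Modules.pullback ((A.quotientBy u K hcov hG hsm hgc).baseChangeToProd D.hat f a' ha')).obj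
          (A.poincarePullbackBundle u K hK hcov hG hsm hgc D hfree).L) →
      a ≫ (D.hat.quotientMk u K' hcov').left = a' ≫ (D.hat.quotientMk u K' hcov').left)
    {T : Scheme.{u}} (f : T ⟶ S) (L : ((A.quotientBy u K hcov hG hsm hgc).baseChange f).X.left.Modules)
    (hex : ∃ g : {g : T ⟶ (D.hat.quotientBy u K' hcov' hG' hsm' hgc').X.left //
        g ≫ (D.hat.quotientBy u K' hcov' hG' hsm' hgc').X.hom = f},
      Nonempty ((Scheme.Modules.pullback ((A.quotientBy u K hcov hG hsm hgc).baseChangeToProd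
        (D.hat.quotientBy u K' hcov' hG' hsm' hgc') f g.1 g.2)).obj
          (A.poincareQuotRigid u K hK hcov hG hsm hgc D hfree K' hcov' hG' hsm' hgc' Φ) ≅ L)) :
    ∃! g : {g : T ⟶ (D.hat.quotientBy u K' hcov' hG' hsm' hgc').X.left //
        g ≫ (D.hat.quotientBy u K' hcov' hG' hsm' hgc').X.hom = f},
      Nonempty ((Scheme.Modules.pullback ((A.quotientBy u K hcov hG hsm hgc).baseChangeToProd
        (D.hat.quotientBy u K' hcov' hG' hsm' hgc') f g.1 g.2)).obj
          (A.poincareQuotRigid u K hK hcov hG hsm hgc D hfree K' hcov' hG' hsm' hgc' Φ) ≅ L) := by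
  haveI : Surjective (show D.hat.X ⟶ (D.hat.quotientBy u K' hcov' hG' hsm' hgc').X from
      D.hat.quotientMk u K' hcov').left := ⟨D.hat.quotientMk_left_surjective u K' hcov'⟩
  haveI := A.flat_quotientMk_left' u D K' hcov' hG' hsm' hgc' hfree'
  haveI := A.quasiCompact_quotientMk_left' u D K' hcov' hG' hsm' hgc'
  exact (A.quotientBy u K hcov hG hsm hgc).existsUnique_of_exists_of_stabilizer D.hat
    (D.hat.quotientBy u K' hcov' hG' hsm' hgc')
    (show D.hat.X ⟶ (D.hat.quotientBy u K' hcov' hG' hsm' hgc').X from D.hat.quotientMk u K' hcov')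
    (A.poincarePullbackBundle u K hK hcov hG hsm hgc D hfree).L
    (A.poincareQuotRigid u K hK hcov hG hsm hgc D hfree K' hcov' hG' hsm' hgc' Φ)
    (A.nonempty_pullback_whiskerLeft_poincareQuotRigid_iso u K hK hcov hG hsm hgc D hfree K' hcov' hG' hsm' hgc' hfree' Φ)
    hStab f L hex

end AbelianSchemeOver

end Literature.AlgebraicGeometry.AbelianSchemes

end
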